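import Summits.BirchSwinnertonDyer.BirchSwinnertonDyer.Theorems.ByReductionTypeAtTwoAdditivePotMultConjATwoTorsionPointFieldDoor
import HarnessLib

/-!
# C4″ `AdditivePotMultOverKAtTwo` (item stmt-BirchSwinnertonDyer-22618), the (A)₂ input (I1M′): CARRIER WIDENING on the `0 < Δ` half —
# statement (A) at `(W, 2)` from `μ₂ = 0` of `ℚ(x(T), x)` for ANY admissible `x ∈ ℚ(E[2], μ_{2^∞})` making the carrier totally complex
# (`x² ∈ {−1, −2, −Δ, −2Δ}`), every model; the generic door over any number field

Cell `bsd-2adic`, seat `bsd-2adic-k4-w3` GEN 10 (explicit unit (309)(7); `--supports 22618`; sequel of `…ConjATwoTorsionPointFieldDoor`).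
HONEST FRAMING (D-0036/D-0054): THEOREMS ONLY — no definition, no named fact, no `sorry`; closes nothing at the `∀`-level; nothing booked;
BSD is not proved by any of this. The `μ₂ = 0` inputs are OPEN Iwasawa statements for explicit sextic CM-fields; nothing is asserted about them.

WHY. On the `0 < Δ` rows (C4″: 81 classes; C1″: k4-w1's 7 «hLim2-alone» rows) the cubic `F = ℚ(x(T))` is totally real and the KERNEL
roads into (A)₂ need a totally complex carrier (w2 GEN 6's `F(√−1)`, p718233; w2 GEN 8's narrow `μ` of `F`). Per row they are decided by
Fukuda-type parities, which can fail because ONE carrier has an even class number (k4-w1 GEN 8 on 100560c1: `h(F(√−1))` is even). The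
descent behind p718233 uses of `i` only that (1) `i` is fixed by every `g` fixing `E[2]` pointwise with `χ₂(g) = 1` and (2) `F(i)` is totally
complex. §1 re-runs it for ANY such `x`; §2 supplies admissible `x` (`2`-power roots of unity, `√−2 = ζ₈ + ζ₈³`, `4δ = √Δ ∈ K(E[2])`, their
products and negatives); §3 gives the `β = x(T)`-currency doors over `ℚ` for the carriers `ℚ(β, √−2)` (sign-free), `ℚ(β, √−Δ)`, `ℚ(β, √−2Δ)`
(`0 < Δ`); §4 the `0 < Δ` half of v11's binder (I1M′) from «`μ₂ = 0` for SOME admissible carrier at each curve» (its composition with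
GEN 9's H3M⁻ into (I1M′) VERBATIM is the sequel `…ConjATwoBinderSplit`).

References: [Lim2017FineSelmer] §3 Thm. 3.5, Lemma 3.2; [CoatesSujatha2005] Conj. A, Thm. 3.4; [Iwasawa1973MuInvariants] §1; [SilvermanAEC2009]
III.§1, III.§7, VIII.§1; [Serre1968] Ch. I §1.2; [DokchitserDokchitserMathZ2012] Theorem (1), proof; [Washington1997] §13.1; tree p718233 (w2 GEN 6).
-/

set_option autoImplicit false
-- the Theorems namespace of this sub repeats the summit name by design (D-0017 nested layout)
set_option linter.dupNamespace false

noncomputable section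

open scoped Classical NumberField Polynomial IntermediateField

namespace Summit.BirchSwinnertonDyer.BirchSwinnertonDyer.Theorems.AddKatoTwo

open WeierstrassCurve NumberField IsDedekindDomain Field Polynomial IntermediateField
open Literature.NumberTheory.EllipticCurves Literature.NumberTheory.EllipticCurves.GreenbergSelmer
  Literature.NumberTheory.EllipticCurves.ZpExtension Literature.NumberTheory.GaloisRepresentations Literature.NumberTheory.IwasawaTheory
  Literature.NumberTheory.EllipticCurves.Rank1Residual
  Literature.NumberTheory.EllipticCurves.DokchitserDokchitser2012
open Summit.BirchSwinnertonDyer.BirchSwinnertonDyer.Theorems.AlignedTransportAtTwoFineRoad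
open Summit.BirchSwinnertonDyer.BirchSwinnertonDyer.Theorems.AlignedTransportAtTwoTorsionPointField
open Summit.BirchSwinnertonDyer.BirchSwinnertonDyer.Theorems.SteinbergFibreAtTwo

/-! ## §1 The generic door: any admissible `x` (every number field `K`) -/

section Generic

variable {K : Type} [Field K] [NumberField K] (W : WeierstrassCurve K) [W.IsElliptic]

/-- **Statement (A) at `(E, 2)` DOWNSTAIRS from `μ₂ = 0` on the carrier `F = K(P) ⊔ K⟮x⟯ for ANY admissible `x`**: w2 GEN 6's
`PointFieldMu.exists_fineSelmerDualData_moduleFinite_of_classicalMu_pointField_adjoin` (the case `x = i`) with `i` replaced by any `x ∈ K̄`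
that is (1) fixed by every `g ∈ Γ_K` fixing `E[2]` pointwise with `χ₂(g) = 1` and (2) such that `F = K̄^{Stab P} ⊔ K⟮x⟯` is totally complex
(`E = W/K` elliptic over a number field, `P ∈ E[2] ∖ 0`). The proof is w2's VERBATIM but for the step «`g` fixes `i`» ↦ hypothesis (1) at the
conjugates `ρ⁻¹gρ` (upstairs prime-wise finiteness `FineSelmerUpstairs.finite_primewiseFine_pTorsion_galImage_of_unipotent` with flag
`ℤ·(σ₀ • P)`; descent `PointFieldMu.finite_pTorsion_fineRelaxed_of_primewise_upstairs` with `N = ker ρ̄_{E,2} ⊓ ker χ₂`; relaxed ⟹ strict; `∃ γ D`).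
[cite: Lim2017FineSelmer, §3 Thm. 3.5 and Lemma 3.2] [cite: CoatesSujatha2005, statement (A), Thm. 3.4] [cite: Iwasawa1973MuInvariants, §1 (input only)] -/
theorem exists_fineSelmerDualData_moduleFinite_of_classicalMu_pointField_adjoin_of_fixed {P : geomTorsion W 2} (hP : P ≠ 0)
    {x : AlgebraicClosure K}
    (hx : ∀ g : absoluteGaloisGroup K, (∀ T : geomTorsion W ((2 : ℕ) : ℤ), g • T = T) →
      GaloisRep.cyclotomicCharacter K 2 g = 1 → g • x = x)
    (hxc : ∀ w : InfinitePlace ↥(IntermediateField.fixedField (MulAction.stabilizer (absoluteGaloisGroup K) P) ⊔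
      IntermediateField.adjoin K ({x} : Set (AlgebraicClosure K))), w.IsComplex)
    (hμ : ∀ κF : ZpExtension ↥(IntermediateField.fixedField (MulAction.stabilizer (absoluteGaloisGroup K) P) ⊔
        IntermediateField.adjoin K ({x} : Set (AlgebraicClosure K))) 2, κF.IsCyclotomic → ClassicalMuVanishes κF)
    (κ : ZpExtension K 2) (hκ : κ.IsCyclotomic) :
    ∃ (γ : absoluteGaloisGroup K) (D : W.FineSelmerDualData κ γ),
      Module.Finite ℤ_[2] (RestrictScalars ℤ_[2] (IwasawaAlgebra 2) D.X) := by
  haveI : Fact (Nat.Prime 2) := ⟨Nat.prime_two⟩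
  haveI : NeZero ((2 : ℕ) : K) := ⟨by exact_mod_cast (two_ne_zero : (2 : K) ≠ 0)⟩
  -- the carrier `F`: a totally complex number field
  have hint : IsIntegral K x := (Algebra.IsAlgebraic.isAlgebraic (R := K) x).isIntegral
  haveI := IntermediateField.adjoin.finiteDimensional hint
  haveI := finiteDimensional_fixedField_stabilizer W P
  haveI : NumberField ↥(IntermediateField.fixedField (MulAction.stabilizer (absoluteGaloisGroup K) P) ⊔
      IntermediateField.adjoin K ({x} : Set (AlgebraicClosure K))) := NumberField.of_module_finite K _
  have hFc := hxc
  -- a cyclotomic `ℤ₂`-extension of `F`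
  obtain ⟨κF, hκF⟩ := ZpExtension.exists_isCyclotomic_holds
    (↥(IntermediateField.fixedField (MulAction.stabilizer (absoluteGaloisGroup K) P) ⊔
      IntermediateField.adjoin K ({x} : Set (AlgebraicClosure K)))) 2 (GaloisRep.cyclotomicCharacter_range_infinite _ 2)
  -- the unipotent flag `ℤ·(σ₀ • P)`
  obtain ⟨σ₀, hσ₀⟩ := PointFieldMu.exists_smul_twoTorsion_fixed_by_resGal W P x
  have hP' : σ₀ • P ≠ 0 := fun h ↦ hP (by rw [← inv_smul_smul σ₀ P, h, smul_zero])
  set C : AddSubgroup (geomTorsion W ((2 : ℕ) : ℤ)) := AddSubgroup.zmultiples (σ₀ • P) with hC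
  have hC1 : ∀ (τ : absoluteGaloisGroup ↥(IntermediateField.fixedField (MulAction.stabilizer (absoluteGaloisGroup K) P) ⊔
      IntermediateField.adjoin K ({x} : Set (AlgebraicClosure K)))) (Q : geomTorsion W ((2 : ℕ) : ℤ)),
      Q ∈ C → resGal (K := K) _ τ • Q = Q := by
    intro τ Q hQ
    obtain ⟨k, rfl⟩ := AddSubgroup.mem_zmultiples_iff.mp hQ
    rw [show resGal (K := K) _ τ • (k • (σ₀ • P)) = k • (resGal (K := K) _ τ • (σ₀ • P)) from
      map_zsmul (DistribSMul.toAddMonoidHom (geomTorsion W ((2 : ℕ) : ℤ)) (resGal (K := K) _ τ)) k (σ₀ • P), hσ₀ τ]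
  have hC2 : ∀ (τ : absoluteGaloisGroup ↥(IntermediateField.fixedField (MulAction.stabilizer (absoluteGaloisGroup K) P) ⊔
      IntermediateField.adjoin K ({x} : Set (AlgebraicClosure K)))) (Q : geomTorsion W ((2 : ℕ) : ℤ)),
      resGal (K := K) _ τ • Q - Q ∈ C :=
    fun τ Q ↦ smul_sub_mem_zmultiples_of_smul_eq hP' (hσ₀ τ) Q
  -- upstairs, prime-wise, over `Ω = galImage(ker κ_F)`
  have hup := FineSelmerUpstairs.finite_primewiseFine_pTorsion_galImage_of_unipotent W hFc C hC1 hC2 κF hκF (hμ κF hκF)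
  -- `N = ker ρ̄_{E,2} ⊓ ker χ₂ ≤ Ω ≤ ker κ`
  have hkerF := FineSelmerFiniteOfUnramifiedClasses.kerSubgroup_eq_comap_of_isCyclotomic κ hκ κF hκF
  have hΩ : BaseChangeModel.galImage K _ κF.kerSubgroup ≤ κ.kerSubgroup := by
    unfold BaseChangeModel.galImage
    rw [resGal_eq_absGaloisRestrict, hkerF]
    exact Subgroup.map_comap_le _ _
  obtain ⟨e, he⟩ := exists_mem_range_absGaloisRestrict_iff K
    ↥(IntermediateField.fixedField (MulAction.stabilizer (absoluteGaloisGroup K) P) ⊔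
      IntermediateField.adjoin K ({x} : Set (AlgebraicClosure K)))
  have hNΩ : (W.galoisRepTorsion 2).ker ⊓ (GaloisRep.cyclotomicCharacter K 2).toMonoidHom.ker ≤
      BaseChangeModel.galImage K _ κF.kerSubgroup := by
    intro g hg
    obtain ⟨hρ, hχ⟩ := Subgroup.mem_inf.1 hg
    rw [MonoidHom.mem_ker] at hρ hχ
    change GaloisRep.cyclotomicCharacter K 2 g = 1 at hχ
    have hρ' : ∀ T : geomTorsion W ((2 : ℕ) : ℤ), g • T = T := fun T ↦ by
      rw [← galoisRepTorsion_apply]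
      have e2 : W.galoisRepTorsion ((2 : ℕ) : ℤ) g = 1 := hρ
      rw [e2]
      rfl
    -- `g` (and every Γ_K-conjugate of it) fixes `F` pointwise: it stabilises every `2`-torsion point and has `χ₂ = 1`, hence fixes `x`
    have hfixF : ∀ (ρ : absoluteGaloisGroup K) (y : AlgebraicClosure K),
        y ∈ IntermediateField.fixedField (MulAction.stabilizer (absoluteGaloisGroup K) P) ⊔
          IntermediateField.adjoin K ({x} : Set (AlgebraicClosure K)) → (ρ⁻¹ * g * ρ) • y = y := by
      intro ρ y hy
      have hmem : absoluteGaloisGroup.toAlgEquiv K (ρ⁻¹ * g * ρ) ∈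
          (IntermediateField.fixedField (MulAction.stabilizer (absoluteGaloisGroup K) P) ⊔
            IntermediateField.adjoin K ({x} : Set (AlgebraicClosure K))).fixingSubgroup := by
        rw [IntermediateField.fixingSubgroup_sup]
        refine ⟨?_, ?_⟩
        · -- `ρ⁻¹ g ρ ∈ Stab P ≤ fixingSubgroup (fixedField (Stab P))`
          have hst : ρ⁻¹ * g * ρ ∈ MulAction.stabilizer (absoluteGaloisGroup K) P := by
            rw [MulAction.mem_stabilizer_iff, mul_smul, mul_smul, hρ' (ρ • P), inv_smul_smul]
          exact (IntermediateField.le_iff_le _ _).1 le_rfl hst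
        · refine (FineSelmerUpstairs.mem_fixingSubgroup_adjoin_simple_iff x _).2 ?_
          rw [← absoluteGaloisGroup.smul_def]
          refine hx (ρ⁻¹ * g * ρ) (fun T ↦ by rw [mul_smul, mul_smul, hρ' (ρ • T), inv_smul_smul]) ?_
          rw [map_mul, map_mul, hχ, mul_one, ← map_mul, inv_mul_cancel, map_one]
      rw [absoluteGaloisGroup.smul_def]
      exact (IntermediateField.mem_fixingSubgroup_iff _ _).1 hmem y hy
    -- hence `g` fixes `e(F)`: `e` extends to some `σ ∈ Γ_K` with `e y = σ • y`
    have hrange : g ∈ (absGaloisRestrict K ↥(IntermediateField.fixedField (MulAction.stabilizer (absoluteGaloisGroup K) P) ⊔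
        IntermediateField.adjoin K ({x} : Set (AlgebraicClosure K)))).range := by
      refine (he g).2 fun y ↦ ?_
      let eL : AlgebraicClosure K →ₐ[K] AlgebraicClosure K := e.liftNormal (AlgebraicClosure K)
      have heL : eL (y : AlgebraicClosure K) = e y := by
        have h := e.liftNormal_commutes (AlgebraicClosure K) y
        simpa using h
      let σ' : AlgebraicClosure K ≃ₐ[K] AlgebraicClosure K :=
        AlgEquiv.ofBijective eL (Algebra.IsAlgebraic.algHom_bijective eL)
      set σ : absoluteGaloisGroup K := (absoluteGaloisGroup.toAlgEquiv K).symm σ' with hσdef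
      have hσ : absoluteGaloisGroup.toAlgEquiv K σ = σ' := (absoluteGaloisGroup.toAlgEquiv K).apply_symm_apply σ'
      have hey : (e y : AlgebraicClosure K) = σ • (y : AlgebraicClosure K) := by
        rw [absoluteGaloisGroup.smul_def, hσ]
        exact heL.symm
      rw [hey, show g • σ • (y : AlgebraicClosure K) = σ • ((σ⁻¹ * g * σ) • (y : AlgebraicClosure K)) by
        rw [mul_smul, mul_smul, smul_inv_smul], hfixF σ y y.2]
    unfold BaseChangeModel.galImage
    rw [resGal_eq_absGaloisRestrict, hkerF]
    change g ∈ Subgroup.map (absGaloisRestrict K _).toMonoidHom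
      (Subgroup.comap (absGaloisRestrict K _).toMonoidHom κ.kerSubgroup)
    rw [Subgroup.map_comap_eq]
    refine Subgroup.mem_inf.2 ⟨hrange, ?_⟩
    rw [show κ.kerSubgroup = _ from hκ, Subgroup.mem_comap]
    change GaloisRep.cyclotomicCharacter K 2 g ∈ CommGroup.torsion ℤ_[2]ˣ
    rw [hχ]
    exact (CommGroup.torsion ℤ_[2]ˣ).one_mem
  -- descend
  have hrel := PointFieldMu.finite_pTorsion_fineRelaxed_of_primewise_upstairs W 2 κ hNΩ hΩ
    (PointFieldMu.finiteIndex_upstairs_subgroupOf' W κ hκ) hup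
  obtain ⟨γ₀, hγ₀⟩ : ∃ γ₀ : absoluteGaloisGroup K, κ.IsTopGenerator γ₀ := κ.surjective (Multiplicative.ofAdd 1)
  exact (IwasawaModuleFinitePadicInt.exists_fineSelmerDualData_moduleFinite_iff_finite_pTorsion W κ hγ₀).2
    (LimRelUpstairs.finite_pTorsion_fineSelmer_of_relaxed W κ hrel)

end Generic

/-! ## §2 Admissible elements (fixed by `ker ρ̄_{E,2} ⊓ ker χ₂`); total complexity over `ℚ` -/

section Fixed

variable {K : Type} [Field K]

/-- From `x² = c²` and `σ • c = c`: `σ • x = x` (`x = ±c`). [folklore] -/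
theorem smul_eq_self_of_sq_eq_sq {x c : AlgebraicClosure K} (hxc : x ^ 2 = c ^ 2) {σ : absoluteGaloisGroup K} (hc : σ • c = c) :
    σ • x = x := by
  rcases eq_or_eq_neg_of_sq_eq_sq x c hxc with h | h
  · rw [h, hc]
  · rw [h, smul_neg, hc]

variable (W : WeierstrassCurve K) [W.IsElliptic]

/-- **`4δ ∈ K(E[2])` is fixed by every `σ` fixing `E[2]` pointwise** (`δ = (x₀−x₁)(x₀−x₂)(x₁−x₂)`, `σδ = sign(σ)δ`; `σ` fixes `K`).
[cite: SilvermanAEC2009, III.§1 and VIII.§1] [cite: DokchitserDokchitserMathZ2012, Theorem (1), proof] -/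
theorem smul_four_mul_delta_eq_self (h2 : (2 : K) ≠ 0) {σ : absoluteGaloisGroup K}
    (hσ : ∀ T : W.geomTorsion 2, σ • T = T) : σ • (4 * delta W h2) = 4 * delta W h2 := by
  have hperm : permGal W h2 σ = 1 := by
    ext i
    have hi : permGal W h2 σ i = i := T_injective W h2 (by rw [T_permGal, hσ])
    rw [hi, Equiv.Perm.one_apply]
  rw [smul_mul', smul_delta, hperm, Equiv.Perm.sign_one, Units.val_one, Int.cast_one, one_mul, absoluteGaloisGroup.smul_def,
    map_ofNat]

/-- `(4δ)² = Δ` in `K̄`. [cite: SilvermanAEC2009, III.§1] -/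
theorem four_mul_delta_sq (h2 : (2 : K) ≠ 0) : (4 * delta W h2) ^ 2 = algebraMap K (AlgebraicClosure K) W.Δ := by
  rw [algebraMap_Δ W h2]; ring

variable [CharZero K]

omit W in
/-- **`χ₂(σ) = 1 ⟹ σ` fixes every `2`-power root of unity** (`σζ = ζ^{χ₂(σ) mod 2^k}`, `GaloisRep.cyclotomicCharacter_spec`).
[cite: Serre1968, Ch. I §1.2 (the cyclotomic character)] [cite: Washington1997, §13.1] -/
theorem smul_eq_self_of_pow_two_pow_eq_one_of_cyclotomicCharacter_eq_one {k : ℕ} (hk : 1 ≤ k) (ζ : AlgebraicClosure K)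
    (hζ : ζ ^ 2 ^ k = 1) {σ : absoluteGaloisGroup K} (h : GaloisRep.cyclotomicCharacter K 2 σ = 1) : σ • ζ = ζ := by
  haveI : NeZero ((2 : ℕ) : K) := ⟨by exact_mod_cast (two_ne_zero : (2 : K) ≠ 0)⟩
  haveI : Fact (1 < 2 ^ k) := ⟨Nat.one_lt_two_pow (by omega)⟩
  have hspec := GaloisRep.cyclotomicCharacter_spec K 2 (k := k) σ ζ hζ
  rw [h, Units.val_one, map_one, ZMod.val_one, pow_one] at hspec
  exact hspec

omit W in
/-- **`χ₂(σ) = 1 ⟹ σ` fixes `√−2`** (`x² = −2`): `x = ±(ζ + ζ³)` for a primitive `8`-th root of unity `ζ` (`ζ⁴ = −1`,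
`(ζ + ζ³)² = ζ²(1 + ζ⁴) + 2ζ⁴ = −2`), and `σ` fixes `ζ`. [cite: Washington1997, §13.1] [cite: Serre1968, Ch. I §1.2] -/
theorem smul_eq_self_of_sq_eq_neg_two_of_cyclotomicCharacter_eq_one (x : AlgebraicClosure K) (hx : x ^ 2 = -2)
    {σ : absoluteGaloisGroup K} (h : GaloisRep.cyclotomicCharacter K 2 σ = 1) : σ • x = x := by
  obtain ⟨ζ, hζ⟩ := IsAlgClosed.exists_pow_nat_eq (-1 : AlgebraicClosure K) (by norm_num : 0 < 4)
  have hζ8 : ζ ^ 2 ^ 3 = 1 := by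
    rw [show (2 : ℕ) ^ 3 = 4 * 2 by norm_num, pow_mul, hζ]; norm_num
  have hfix : σ • ζ = ζ := smul_eq_self_of_pow_two_pow_eq_one_of_cyclotomicCharacter_eq_one (by norm_num) ζ hζ8 h
  have hy : (ζ + ζ ^ 3) ^ 2 = -2 := by
    have e : (ζ + ζ ^ 3) ^ 2 = ζ ^ 2 * (1 + ζ ^ 4) + 2 * ζ ^ 4 := by ring
    rw [e, hζ]; ring
  refine smul_eq_self_of_sq_eq_sq (c := ζ + ζ ^ 3) (by rw [hx, hy]) ?_
  rw [smul_add, smul_pow', hfix]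

/-- **`√−Δ` is admissible**: `x² = −Δ` ⟹ `σ • x = x` for every `σ` fixing `E[2]` pointwise with `χ₂(σ) = 1` (`x = ±4iδ`).
[cite: SilvermanAEC2009, III.§1 and VIII.§1] [cite: Serre1968, Ch. I §1.2] -/
theorem smul_eq_self_of_sq_eq_neg_Δ (x : AlgebraicClosure K) (hx : x ^ 2 = -algebraMap K (AlgebraicClosure K) W.Δ)
    {σ : absoluteGaloisGroup K} (hσ : ∀ T : W.geomTorsion 2, σ • T = T) (h : GaloisRep.cyclotomicCharacter K 2 σ = 1) :
    σ • x = x := by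
  obtain ⟨i, hi⟩ := IsAlgClosed.exists_pow_nat_eq (-1 : AlgebraicClosure K) two_pos
  have hi4 : i ^ 2 ^ 2 = 1 := by rw [show (2 : ℕ) ^ 2 = 2 * 2 by norm_num, pow_mul, hi]; norm_num
  refine smul_eq_self_of_sq_eq_sq (c := i * (4 * delta W two_ne_zero)) ?_ ?_
  · rw [mul_pow, hi, four_mul_delta_sq W two_ne_zero, hx]; ring
  · rw [smul_mul', smul_eq_self_of_pow_two_pow_eq_one_of_cyclotomicCharacter_eq_one (by norm_num) i hi4 h,
      smul_four_mul_delta_eq_self W two_ne_zero hσ]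

/-- **`√−2Δ` is admissible**: `x² = −2Δ` ⟹ `σ • x = x` for every `σ` fixing `E[2]` pointwise with `χ₂(σ) = 1` (`x = ±4·√−2·δ`).
[cite: SilvermanAEC2009, III.§1 and VIII.§1] [cite: Washington1997, §13.1] -/
theorem smul_eq_self_of_sq_eq_neg_two_mul_Δ (x : AlgebraicClosure K) (hx : x ^ 2 = -2 * algebraMap K (AlgebraicClosure K) W.Δ)
    {σ : absoluteGaloisGroup K} (hσ : ∀ T : W.geomTorsion 2, σ • T = T) (h : GaloisRep.cyclotomicCharacter K 2 σ = 1) :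
    σ • x = x := by
  obtain ⟨s, hs⟩ := IsAlgClosed.exists_pow_nat_eq (-2 : AlgebraicClosure K) two_pos
  refine smul_eq_self_of_sq_eq_sq (c := s * (4 * delta W two_ne_zero)) ?_ ?_
  · rw [mul_pow, hs, four_mul_delta_sq W two_ne_zero, hx]
  · rw [smul_mul', smul_eq_self_of_sq_eq_neg_two_of_cyclotomicCharacter_eq_one s hs h,
      smul_four_mul_delta_eq_self W two_ne_zero hσ]

end Fixed

section Complex

/-- **A subfield of `ℚ̄` containing an `x` with `x² = q < 0` rational is totally complex** (a real place would give a real number of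
negative square). [cite: Lim2017FineSelmer, §3 proof of Thm. 3.1 (no real primes)] -/
theorem isComplex_of_mem_sq_eq_neg_rat (x : AlgebraicClosure ℚ) {q : ℚ} (hq : q < 0)
    (hx : x ^ 2 = algebraMap ℚ (AlgebraicClosure ℚ) q) (L : IntermediateField ℚ (AlgebraicClosure ℚ)) (hxL : x ∈ L)
    (w : InfinitePlace L) : w.IsComplex := by
  rw [← InfinitePlace.not_isReal_iff_isComplex]
  intro hw
  rw [InfinitePlace.isReal_iff] at hw
  have hx' : x ^ 2 = (q : AlgebraicClosure ℚ) := by rw [hx, eq_ratCast]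
  have hsq : (⟨x, hxL⟩ : L) ^ 2 = (q : L) := Subtype.ext (by simpa using hx')
  have h1 : (hw.embedding ⟨x, hxL⟩) ^ 2 = (q : ℝ) := by
    rw [← map_pow, hsq, map_ratCast]
  have hq' : (q : ℝ) < 0 := by exact_mod_cast hq
  nlinarith [sq_nonneg (hw.embedding ⟨x, hxL⟩)]

end Complex

/-! ## §3 Over `ℚ`, every model, `β = x(T)`-currency: the carriers `ℚ(β, √−2)`, `ℚ(β, √−Δ)`, `ℚ(β, √−2Δ)` -/

section RatDoors

variable (W : WeierstrassCurve ℚ) [W.IsElliptic]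

/-- **(A)₂(W) from `μ₂ = 0` of `ℚ(β) ⊔ ℚ(x)` for any admissible `x` with `x² = q < 0` rational** — every model, `β` a root of the
`2`-division cubic: admissibility = `x` fixed by every `σ` fixing `W[2]` pointwise with `χ₂(σ) = 1`. §1 at the point `P` with `ℚ̄^{Stab P} =
ℚ⟮β⟯` (`exists_geomTorsion_two_ne_zero_fixedField_stabilizer_eq_adjoin`); total complexity from `x² < 0`.
[cite: CoatesSujatha2005, Conj. A and Thm. 3.4] [cite: Lim2017FineSelmer, §3 Thm. 3.5 and Lemma 3.2] -/
theorem conjA_two_of_classicalMu_cubicField_adjoin_of_fixed {β : AlgebraicClosure ℚ} (hβ : aeval β W.twoTorsionPolynomial.toPoly = 0)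
    {x : AlgebraicClosure ℚ} {q : ℚ} (hq : q < 0) (hxq : x ^ 2 = algebraMap ℚ (AlgebraicClosure ℚ) q)
    (hx : ∀ g : absoluteGaloisGroup ℚ, (∀ T : W.geomTorsion ((2 : ℕ) : ℤ), g • T = T) →
      GaloisRep.cyclotomicCharacter ℚ 2 g = 1 → g • x = x)
    (hμ : ∀ κF : ZpExtension ↥(IntermediateField.adjoin ℚ ({β} : Set (AlgebraicClosure ℚ)) ⊔
        IntermediateField.adjoin ℚ ({x} : Set (AlgebraicClosure ℚ))) 2, κF.IsCyclotomic → ClassicalMuVanishes κF)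
    (κ : ZpExtension ℚ 2) (hκ : κ.IsCyclotomic) :
    ∃ (γ : absoluteGaloisGroup ℚ) (D : W.FineSelmerDualData κ γ),
      Module.Finite ℤ_[2] (RestrictScalars ℤ_[2] (IwasawaAlgebra 2) D.X) := by
  obtain ⟨P, hP, hF⟩ := exists_geomTorsion_two_ne_zero_fixedField_stabilizer_eq_adjoin W hβ
  have hxc : ∀ w : InfinitePlace ↥(IntermediateField.fixedField (MulAction.stabilizer (absoluteGaloisGroup ℚ) P) ⊔
      IntermediateField.adjoin ℚ ({x} : Set (AlgebraicClosure ℚ))), w.IsComplex :=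
    isComplex_of_mem_sq_eq_neg_rat x hq hxq _
      ((le_sup_right : IntermediateField.adjoin ℚ ({x} : Set (AlgebraicClosure ℚ)) ≤ _) (IntermediateField.mem_adjoin_simple_self ℚ x))
  refine exists_fineSelmerDualData_moduleFinite_of_classicalMu_pointField_adjoin_of_fixed W hP hx hxc ?_ κ hκ
  rw [hF]
  exact hμ

/-- **(A)₂(W) from `μ₂ = 0` of the sextic `ℚ(β, √−2)`** — every model, every sign of `Δ` (`x² = −2`; `√−2 = ζ₈ + ζ₈³ ∈ ℚ(μ₈)`).
[cite: CoatesSujatha2005, Conj. A and Thm. 3.4] [cite: Lim2017FineSelmer, §3 Thm. 3.5 and Lemma 3.2] [cite: Washington1997, §13.1] -/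
theorem conjA_two_of_classicalMu_cubicField_adjoin_sqrt_neg_two {β : AlgebraicClosure ℚ}
    (hβ : aeval β W.twoTorsionPolynomial.toPoly = 0) {x : AlgebraicClosure ℚ} (hx : x ^ 2 = -2)
    (hμ : ∀ κF : ZpExtension ↥(IntermediateField.adjoin ℚ ({β} : Set (AlgebraicClosure ℚ)) ⊔
        IntermediateField.adjoin ℚ ({x} : Set (AlgebraicClosure ℚ))) 2, κF.IsCyclotomic → ClassicalMuVanishes κF)
    (κ : ZpExtension ℚ 2) (hκ : κ.IsCyclotomic) :
    ∃ (γ : absoluteGaloisGroup ℚ) (D : W.FineSelmerDualData κ γ),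
      Module.Finite ℤ_[2] (RestrictScalars ℤ_[2] (IwasawaAlgebra 2) D.X) :=
  conjA_two_of_classicalMu_cubicField_adjoin_of_fixed W hβ (q := -2) (by norm_num) (by rw [hx]; simp)
    (fun _ _ hχ ↦ smul_eq_self_of_sq_eq_neg_two_of_cyclotomicCharacter_eq_one x hx hχ) hμ κ hκ

/-- **(A)₂(W) from `μ₂ = 0` of the sextic `ℚ(β, √−Δ)`** — every model with `0 < Δ(W)` (`x² = −Δ(W)`; `√−Δ = 4iδ ∈ ℚ(E[2], i)`;
`ℚ(√−Δ) = ℚ(√−d)` for the square-free kernel `d` of `Δ`). [cite: CoatesSujatha2005, Conj. A and Thm. 3.4] [cite: SilvermanAEC2009, III.§1 and VIII.§1] -/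
theorem conjA_two_of_classicalMu_cubicField_adjoin_sqrt_neg_Δ (hΔ : 0 < W.Δ) {β : AlgebraicClosure ℚ}
    (hβ : aeval β W.twoTorsionPolynomial.toPoly = 0) {x : AlgebraicClosure ℚ}
    (hx : x ^ 2 = -algebraMap ℚ (AlgebraicClosure ℚ) W.Δ)
    (hμ : ∀ κF : ZpExtension ↥(IntermediateField.adjoin ℚ ({β} : Set (AlgebraicClosure ℚ)) ⊔
        IntermediateField.adjoin ℚ ({x} : Set (AlgebraicClosure ℚ))) 2, κF.IsCyclotomic → ClassicalMuVanishes κF)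
    (κ : ZpExtension ℚ 2) (hκ : κ.IsCyclotomic) :
    ∃ (γ : absoluteGaloisGroup ℚ) (D : W.FineSelmerDualData κ γ),
      Module.Finite ℤ_[2] (RestrictScalars ℤ_[2] (IwasawaAlgebra 2) D.X) :=
  conjA_two_of_classicalMu_cubicField_adjoin_of_fixed W hβ (q := -W.Δ) (by linarith) (by rw [hx, map_neg])
    (fun _ hT hχ ↦ smul_eq_self_of_sq_eq_neg_Δ W x hx hT hχ) hμ κ hκ

/-- **(A)₂(W) from `μ₂ = 0` of the sextic `ℚ(β, √−2Δ)`** — every model with `0 < Δ(W)` (`x² = −2Δ(W)`; `√−2Δ = 4·√−2·δ ∈ ℚ(E[2], μ₈)`).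
[cite: CoatesSujatha2005, Conj. A and Thm. 3.4] [cite: Lim2017FineSelmer, §3 Thm. 3.5 and Lemma 3.2] [cite: SilvermanAEC2009, III.§1 and VIII.§1] -/
theorem conjA_two_of_classicalMu_cubicField_adjoin_sqrt_neg_two_mul_Δ (hΔ : 0 < W.Δ) {β : AlgebraicClosure ℚ}
    (hβ : aeval β W.twoTorsionPolynomial.toPoly = 0) {x : AlgebraicClosure ℚ}
    (hx : x ^ 2 = -2 * algebraMap ℚ (AlgebraicClosure ℚ) W.Δ)
    (hμ : ∀ κF : ZpExtension ↥(IntermediateField.adjoin ℚ ({β} : Set (AlgebraicClosure ℚ)) ⊔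
        IntermediateField.adjoin ℚ ({x} : Set (AlgebraicClosure ℚ))) 2, κF.IsCyclotomic → ClassicalMuVanishes κF)
    (κ : ZpExtension ℚ 2) (hκ : κ.IsCyclotomic) :
    ∃ (γ : absoluteGaloisGroup ℚ) (D : W.FineSelmerDualData κ γ),
      Module.Finite ℤ_[2] (RestrictScalars ℤ_[2] (IwasawaAlgebra 2) D.X) :=
  conjA_two_of_classicalMu_cubicField_adjoin_of_fixed W hβ (q := -2 * W.Δ) (by linarith) (by rw [hx, map_mul, map_neg]; simp)
    (fun _ hT hχ ↦ smul_eq_self_of_sq_eq_neg_two_mul_Δ W x hx hT hχ) hμ κ hκ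

end RatDoors

/-! ## §4 v11's binder (I1M′): the `0 < Δ` half from «`μ₂ = 0` for SOME admissible carrier at each curve» -/
/-- **The `0 < Δ` half of (I1M′) — GEN 9's displayed `hPos` — from «at every curve, for every root `β`, SOME `x` with
`x² ∈ {−1, −2, −Δ(W), −2Δ(W)}` has `μ₂ = 0` along the cyclotomic `ℤ₂`-extensions of `ℚ⟮β⟯ ⊔ ℚ⟮x⟯`».** Four totally complex sextic carriers
per curve instead of one (`hAnaMI_of_cubicFieldAdjoinIMu`); each is OPEN per field and decidable per row only by certificates (Fukuda-type
parities of its first layers). [cite: CoatesSujatha2005, Conj. A and Thm. 3.4] [cite: Kato2004Asterisque, Conj. 12.10 (p. 224)] -/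
theorem hAnaMI_posDisc_of_exists_admissibleCarrierMu
    (hμx : ∀ (W : WeierstrassCurve ℚ) [W.IsElliptic] [W.IsGloballyMinimal], ¬ W.HasCM → W.analyticRank = 0 →
      Addv W 2 → padicValRat 2 W.j < 0 → W.HasIrreducibleModPGaloisRep 2 → 0 < W.Δ →
      ∀ β : AlgebraicClosure ℚ, aeval β W.twoTorsionPolynomial.toPoly = 0 →
      ∃ x : AlgebraicClosure ℚ, (x ^ 2 = -1 ∨ x ^ 2 = -2 ∨ x ^ 2 = -algebraMap ℚ (AlgebraicClosure ℚ) W.Δ ∨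
          x ^ 2 = -2 * algebraMap ℚ (AlgebraicClosure ℚ) W.Δ) ∧
        ∀ κF : ZpExtension ↥(IntermediateField.adjoin ℚ ({β} : Set (AlgebraicClosure ℚ)) ⊔
            IntermediateField.adjoin ℚ ({x} : Set (AlgebraicClosure ℚ))) 2, κF.IsCyclotomic → ClassicalMuVanishes κF) :
    ∀ (W : WeierstrassCurve ℚ) [W.IsElliptic] [W.IsGloballyMinimal], ¬ W.HasCM → W.analyticRank = 0 →
      Addv W 2 → padicValRat 2 W.j < 0 → W.HasIrreducibleModPGaloisRep 2 → ¬ IsAbelianGalois ℚ (W.divisionField 2) → 0 < W.Δ →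
      ∀ (κ : ZpExtension ℚ 2), κ.IsCyclotomic →
        ∃ (γ : Field.absoluteGaloisGroup ℚ) (D : W.FineSelmerDualData κ γ),
          Module.Finite ℤ_[2] (RestrictScalars ℤ_[2] (IwasawaAlgebra 2) D.X) := by
  intro W _ _ hcm hr hadd hj hirr _ hΔ κ hκ
  obtain ⟨β, hβ⟩ := exists_aeval_twoTorsionPolynomial_eq_zero W
  obtain ⟨x, hx, hμ⟩ := hμx W hcm hr hadd hj hirr hΔ β hβ
  rcases hx with hx | hx | hx | hx
  · exact conjA_two_of_classicalMu_cubicField_adjoin_I W hβ hx hμ κ hκ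
  · exact conjA_two_of_classicalMu_cubicField_adjoin_sqrt_neg_two W hβ hx hμ κ hκ
  · exact conjA_two_of_classicalMu_cubicField_adjoin_sqrt_neg_Δ W hΔ hβ hx hμ κ hκ
  · exact conjA_two_of_classicalMu_cubicField_adjoin_sqrt_neg_two_mul_Δ W hΔ hβ hx hμ κ hκ

end Summit.BirchSwinnertonDyer.BirchSwinnertonDyer.Theorems.AddKatoTwo

end
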